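import Mathlib
import Literature.Analysis.SpecialFunctions.SemigroupPosDef
import Literature.MeasureTheory.Integral.BernsteinCompletelyMonotone
import HarnessLib

/-!
# Widder's theorem: positive-definite functions on the semigroup `(0,∞)` are Laplace transforms of
# positive measures on `[0,∞)` (measure form, including the unbounded case)

**Theorem** (Widder, *The Laplace Transform* (1941), Ch. VI §19–§21, Thm. 21 («exponentially convex functions»);
Berg–Christensen–Ressel 1984, Ch. 4 Thm. 6.13 with §4.4).  Let `f : ℝ → ℝ` be continuous on `(0,∞)`, POSITIVE
DEFINITE on the additive semigroup `((0,∞),+)` — `∑ᵢⱼ cᵢ cⱼ f(sᵢ + sⱼ) ≥ 0` for all finite families `sᵢ > 0`, `cᵢ ∈ ℝ`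
(written out, as in `Literature/Analysis/SpecialFunctions/SemigroupPosDef.lean`) — and bounded above on every
`[t₀,∞)`, `t₀ > 0` (NOT necessarily bounded near `0`).  Then there is ONE positive measure `μ` on `ℝ` carried by `[0,∞)`
with `∫ e^{-t s} dμ(s) < ∞` and `f t = ∫ e^{-t s} dμ(s)` for EVERY `t > 0` (`exists_measure_laplace_eq_of_semigroupPosDef`);
if `f` is bounded above on all of `(0,∞)` the measure is finite and `f(0+)` is its mass
(`exists_finiteMeasure_laplace_eq_of_semigroupPosDef`).

Proof.  `alternating_of_semigroupPosDef`: the tree's measure-free half (`SemigroupPosDef.iter_fwdDiff_nonneg`: all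
iterated forward differences alternate) rewritten through Newton's formula `fwdDiff_iter_eq_sum_shift` is exactly the
difference-form complete monotonicity `∑_{i ≤ k} (-1)^i C(k,i) f(t + i h) ≥ 0` consumed by Bernstein's theorem
(`exists_measure_laplace_eq_of_alternating`, p686604).  Bounded case: immediate.  Unbounded case: every shift
`f(· + ε)` (`ε > 0`) is bounded, so `f(t + ε) = ∫ e^{-t s} dμ_ε`; put `μ := e^{s}·μ₁`; for `t > 0` and `ε < min(t,1)` the
finite measures `e^{-(1-ε)s} μ_ε` and `μ₁` have the same Laplace transform at `1, 2, 3, …` (both `= f(n + 2)`), hence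
coincide (`measure_eq_of_lintegral_exp_neg_nat_mul_eq`: push-forward by `s ↦ e^{-s}` to `[0,1]`, moments = Laplace values at
`0, 1, 2, …`, Hausdorff–Weierstrass determinacy `integral_eq_of_moments_eq`, pull-back by `-log`), and then
`∫ e^{-t s} e^{s} dμ₁ = ∫ e^{-(t-ε) s} dμ_ε = f(t)`.

Motivation in the tree: the `t`-half, in measure form, of the Laplace–Fourier representation of reflection-positive
two-point kernels (Glimm–Jaffe §6.2; crux ⟨stmt-QuantumFields-23125⟩, LINE g17-A step S1): the slices `t ↦ K(t e₀)` of
such kernels are positive definite on `(0,∞)` and typically `O(t⁻⁸)` at `0`, so the representing measure is infinite —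
the unbounded case above.  Mathlib has no Bernstein–Widder theory (cf. the module docstrings of `SemigroupPosDef.lean`,
`BernsteinCompletelyMonotone.lean`).

## References
* D. V. Widder, *The Laplace Transform*, Princeton Univ. Press (1941), Ch. IV Thm. 12a, Ch. VI Thm. 21. [Widder1941]
* C. Berg, J. P. R. Christensen, P. Ressel, *Harmonic Analysis on Semigroups*, GTM 100 (1984), Ch. 4 §4.4, Thm. 6.13.
  [BergChristensenRessel1984]
-/

noncomputable section

open MeasureTheory Set Filter Topology
open scoped fwdDiff ENNReal NNReal

namespace Literature.MeasureTheory.Integral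

open Literature.Analysis.SpecialFunctions

/-! ## 1. Positive definite ⇒ completely monotone in the difference sense -/

/-- **Positive-definite functions on `((0,∞),+)` bounded on every `[t₀,∞)` have alternating differences**:
`∑_{i ≤ k} (-1)^i C(k,i) f(t + i h) ≥ 0` for `h, t > 0` — the tree's `SemigroupPosDef.iter_fwdDiff_nonneg` read through
Newton's forward-difference formula. [cite: Widder1941, Ch. IV Thm. 12a] [cite: BergChristensenRessel1984, Ch. 4 Thm. 6.13] -/
theorem alternating_of_semigroupPosDef (f : ℝ → ℝ)
    (h : ∀ (m : ℕ) (s c : Fin m → ℝ), (∀ k₀, 0 < s k₀) → 0 ≤ ∑ i₁, ∑ i₂, c i₁ * c i₂ * f (s i₁ + s i₂))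
    (hb : ∀ t₀ : ℝ, 0 < t₀ → ∃ M : ℝ, ∀ τ : ℝ, t₀ ≤ τ → f τ ≤ M)
    (k : ℕ) (hh t : ℝ) (hh0 : 0 < hh) (ht : 0 < t) :
    0 ≤ ∑ i ∈ Finset.range (k + 1), (-1 : ℝ) ^ i * (k.choose i : ℝ) * f (t + i * hh) := by
  have h1 := SemigroupPosDef.iter_fwdDiff_nonneg h hb hh0.le k ht
  rw [fwdDiff_iter_eq_sum_shift, Finset.mul_sum] at h1
  refine h1.trans_eq (Finset.sum_congr rfl fun i hi => ?_)
  have hik : i ≤ k := Nat.lt_succ_iff.mp (Finset.mem_range.mp hi)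
  rw [zsmul_eq_mul, nsmul_eq_mul]
  push_cast
  have hsign : (-1 : ℝ) ^ k * (-1 : ℝ) ^ (k - i) = (-1) ^ i := by
    rw [← pow_add, show k + (k - i) = 2 * (k - i) + i by omega, pow_add, pow_mul]
    norm_num
  calc (-1 : ℝ) ^ k * ((-1 : ℝ) ^ (k - i) * (k.choose i : ℝ) * f (t + (i : ℝ) * hh))
      = ((-1 : ℝ) ^ k * (-1 : ℝ) ^ (k - i)) * (k.choose i : ℝ) * f (t + (i : ℝ) * hh) := by ring
    _ = (-1) ^ i * (k.choose i : ℝ) * f (t + i * hh) := by rw [hsign]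

/-! ## 2. The bounded case: a finite measure -/

/-- **Widder's theorem, bounded case.**  A function continuous on `(0,∞)`, positive definite on `((0,∞),+)` and bounded
above on `(0,∞)` is the Laplace transform of a finite positive measure on `[0,∞)`, with `f(0+)` its mass.
[cite: Widder1941, Ch. VI Thm. 21] [cite: BergChristensenRessel1984, Ch. 4 Thm. 6.13] -/
theorem exists_finiteMeasure_laplace_eq_of_semigroupPosDef (f : ℝ → ℝ) (hc : ContinuousOn f (Ioi 0))
    (h : ∀ (m : ℕ) (s c : Fin m → ℝ), (∀ k₀, 0 < s k₀) → 0 ≤ ∑ i₁, ∑ i₂, c i₁ * c i₂ * f (s i₁ + s i₂))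
    (hbdd : ∃ C : ℝ, ∀ t, 0 < t → f t ≤ C) :
    ∃ μ : Measure ℝ, IsFiniteMeasure μ ∧ μ (Iio 0) = 0 ∧
      (∀ t : ℝ, 0 < t → f t = ∫ s, Real.exp (-(t * s)) ∂μ) ∧
      Tendsto f (𝓝[>] 0) (𝓝 (μ.real univ)) := by
  have hb : ∀ t₀ : ℝ, 0 < t₀ → ∃ M : ℝ, ∀ τ : ℝ, t₀ ≤ τ → f τ ≤ M := by
    intro t₀ ht₀
    obtain ⟨C, hC⟩ := hbdd
    exact ⟨C, fun τ hτ => hC τ (lt_of_lt_of_le ht₀ hτ)⟩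
  exact exists_measure_laplace_eq_of_alternating f hc
    (fun k hh t hh0 ht => alternating_of_semigroupPosDef f h hb k hh t hh0 ht) hbdd

/-! ## 3. Finite measures on `[0,∞)` are determined by their Laplace transforms at `0, 1, 2, …` -/

/-- **Uniqueness**: two finite measures carried by `[0,∞)` with the same Laplace transform at the natural numbers coincide
(push-forward by `s ↦ e^{-s}` onto `[0,1]`, moments, Weierstrass — `integral_eq_of_moments_eq` — and pull-back by `u ↦ -log u`).
[cite: BergChristensenRessel1984, Ch. 4 Prop. 6.11] -/
theorem measure_eq_of_lintegral_exp_neg_nat_mul_eq {P Q : Measure ℝ} [IsFiniteMeasure P] [IsFiniteMeasure Q]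
    (hP : P (Iio 0) = 0) (hQ : Q (Iio 0) = 0)
    (h : ∀ n : ℕ, ∫⁻ a, ENNReal.ofReal (Real.exp (-(n * a))) ∂P = ∫⁻ a, ENNReal.ofReal (Real.exp (-(n * a))) ∂Q) :
    P = Q := by
  have hφ : Measurable (fun a : ℝ => Real.exp (-a)) := Real.measurable_exp.comp measurable_neg
  have hψ : Measurable (fun u : ℝ => -Real.log u) := Real.measurable_log.neg
  -- the push-forwards live on `[0,1]`
  have hcar : ∀ (ρ : Measure ℝ), ρ (Iio 0) = 0 → (ρ.map (fun a : ℝ => Real.exp (-a))) (Icc 0 1)ᶜ = 0 := by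
    intro ρ hR
    rw [Measure.map_apply hφ measurableSet_Icc.compl]
    refine measure_mono_null (fun a ha => ?_) hR
    simp only [mem_preimage, mem_compl_iff, mem_Icc, not_and, not_le] at ha
    by_contra hge
    rw [mem_Iio, not_lt] at hge
    have h1 : Real.exp (-a) ≤ 1 := Real.exp_le_one_iff.2 (by linarith)
    linarith [ha (Real.exp_pos _).le]
  -- moments of the push-forwards are the Laplace values
  have hmomR : ∀ (ρ : Measure ℝ) [IsFiniteMeasure ρ], ρ (Iio 0) = 0 → ∀ n : ℕ,
      ∫ u, u ^ n ∂(ρ.map (fun a : ℝ => Real.exp (-a))) =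
        (∫⁻ a, ENNReal.ofReal (Real.exp (-(n * a))) ∂ρ).toReal := by
    intro ρ _ hR n
    rw [integral_map hφ.aemeasurable (continuous_pow n).aestronglyMeasurable]
    have hnn : 0 ≤ᵐ[ρ] fun a : ℝ => Real.exp (-a) ^ n := ae_of_all _ fun a => pow_nonneg (Real.exp_pos _).le n
    rw [integral_eq_lintegral_of_nonneg_ae hnn (by fun_prop)]
    congr 1
    refine lintegral_congr fun a => ?_
    rw [← Real.exp_nat_mul]; ring_nf
  have hmom : ∀ n : ℕ, ∫ u, u ^ n ∂(P.map (fun a : ℝ => Real.exp (-a))) =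
      ∫ u, u ^ n ∂(Q.map (fun a : ℝ => Real.exp (-a))) := by
    intro n; rw [hmomR P hP n, hmomR Q hQ n, h n]
  -- Weierstrass: equal integrals of all continuous functions, hence equal push-forwards
  have hPQ : P.map (fun a : ℝ => Real.exp (-a)) = Q.map (fun a : ℝ => Real.exp (-a)) :=
    ext_of_forall_integral_eq_of_IsFiniteMeasure fun g =>
      BernsteinCompletelyMonotone.integral_eq_of_moments_eq (hcar P hP) (hcar Q hQ) hmom g.continuous
  -- pull back by `-log`
  have hback : ∀ ρ : Measure ℝ, (ρ.map (fun a : ℝ => Real.exp (-a))).map (fun u : ℝ => -Real.log u) = ρ := by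
    intro ρ
    rw [Measure.map_map hψ hφ]
    have : (fun u : ℝ => -Real.log u) ∘ (fun a : ℝ => Real.exp (-a)) = id := by
      funext a; simp
    rw [this, Measure.map_id]
  rw [← hback P, ← hback Q, hPQ]

/-! ## 4. The general case: one (possibly infinite) measure for all `t > 0` -/

/-- The representing measure of a shift `f(· + ε)`, in Lebesgue-integral currency: `∫⁻ e^{-t s} dμ_ε = f(t + ε)`.
[folklore] -/
private theorem lintegral_exp_neg_eq_ofReal {g : ℝ → ℝ} {μ : Measure ℝ} [IsFiniteMeasure μ] (hμ0 : μ (Iio 0) = 0)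
    (hrep : ∀ t : ℝ, 0 < t → g t = ∫ s, Real.exp (-(t * s)) ∂μ) {t : ℝ} (ht : 0 < t) :
    ∫⁻ s, ENNReal.ofReal (Real.exp (-(t * s))) ∂μ = ENNReal.ofReal (g t) := by
  have hae : ∀ᵐ s ∂μ, s ∈ Ici (0 : ℝ) := by
    rw [ae_iff]
    have : {a : ℝ | a ∉ Ici (0 : ℝ)} = Iio 0 := by ext a; simp
    rwa [this]
  have hint : Integrable (fun s => Real.exp (-(t * s))) μ := by
    refine (integrable_const (1 : ℝ)).mono' (by fun_prop) ?_
    filter_upwards [hae] with s hs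
    rw [Real.norm_eq_abs, abs_of_pos (Real.exp_pos _)]
    exact Real.exp_le_one_iff.2 (by nlinarith [mem_Ici.1 hs])
  rw [hrep t ht, ofReal_integral_eq_lintegral_ofReal hint (ae_of_all _ fun s => (Real.exp_pos _).le)]

/-- **Widder's theorem, general case.**  A function continuous on `(0,∞)`, positive definite on `((0,∞),+)` and
bounded above on every `[t₀,∞)` (`t₀ > 0`) is the Laplace transform of ONE positive measure `μ` on `[0,∞)`:
`e^{-t·}` is `μ`-integrable and `f t = ∫ e^{-t s} dμ(s)` for every `t > 0`.  The measure is infinite exactly when `f` is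
unbounded at `0⁺`. [cite: Widder1941, Ch. VI Thm. 21] [cite: BergChristensenRessel1984, Ch. 4 §4.4] -/
theorem exists_measure_laplace_eq_of_semigroupPosDef (f : ℝ → ℝ) (hc : ContinuousOn f (Ioi 0))
    (h : ∀ (m : ℕ) (s c : Fin m → ℝ), (∀ k₀, 0 < s k₀) → 0 ≤ ∑ i₁, ∑ i₂, c i₁ * c i₂ * f (s i₁ + s i₂))
    (hb : ∀ t₀ : ℝ, 0 < t₀ → ∃ M : ℝ, ∀ τ : ℝ, t₀ ≤ τ → f τ ≤ M) :
    ∃ μ : Measure ℝ, μ (Iio 0) = 0 ∧ ∀ t : ℝ, 0 < t →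
      Integrable (fun s => Real.exp (-(t * s))) μ ∧ f t = ∫ s, Real.exp (-(t * s)) ∂μ := by
  -- every shift `f(· + ε)` is bounded, hence a finite Laplace transform, with `f ε⁺… = f(ε)`-mass
  have hshift : ∀ ε : ℝ, 0 < ε → ∃ μ : Measure ℝ, IsFiniteMeasure μ ∧ μ (Iio 0) = 0 ∧
      (∀ t : ℝ, 0 < t → f (t + ε) = ∫ s, Real.exp (-(t * s)) ∂μ) ∧ μ.real univ = f ε := by
    intro ε hε
    have hcε : ContinuousOn (fun t => f (t + ε)) (Ioi 0) :=
      hc.comp (continuous_add_const ε).continuousOn fun t ht => by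
        simp only [mem_Ioi] at ht ⊢; linarith
    obtain ⟨M, hM⟩ := hb ε hε
    obtain ⟨μ, hfin, hμ0, hrep, hlim⟩ := exists_finiteMeasure_laplace_eq_of_semigroupPosDef (fun t => f (t + ε))
      hcε (SemigroupPosDef.shift h hε.le) ⟨M, fun t ht => hM _ (by linarith)⟩
    refine ⟨μ, hfin, hμ0, hrep, ?_⟩
    -- the mass is `f(ε)` by continuity of `f` at `ε`
    have hct : ContinuousAt f ε := hc.continuousAt (Ioi_mem_nhds hε)
    have h2 : Tendsto (fun t : ℝ => f (t + ε)) (𝓝[>] 0) (𝓝 (f ε)) := by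
      have h3 : Tendsto (fun t : ℝ => t + ε) (𝓝[>] (0 : ℝ)) (𝓝 ε) := by
        have := ((continuous_add_const ε).tendsto (0 : ℝ)).mono_left (nhdsWithin_le_nhds (s := Ioi (0 : ℝ)))
        rwa [zero_add] at this
      exact hct.tendsto.comp h3
    exact tendsto_nhds_unique hlim h2
  obtain ⟨μ₁, hfin₁, hμ₁0, hrep₁, hmass₁⟩ := hshift 1 one_pos
  -- the densities `e^{c s}`
  have hmeas : ∀ c : ℝ, Measurable fun s : ℝ => ENNReal.ofReal (Real.exp (c * s)) := fun c =>
    (Real.measurable_exp.comp (measurable_const.mul measurable_id)).ennreal_ofReal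
  have hmul : ∀ (c d s : ℝ), ENNReal.ofReal (Real.exp (c * s)) * ENNReal.ofReal (Real.exp (d * s)) =
      ENNReal.ofReal (Real.exp ((c + d) * s)) := fun c d s => by
    rw [← ENNReal.ofReal_mul (Real.exp_pos _).le, ← Real.exp_add]; ring_nf
  refine ⟨μ₁.withDensity (fun s => ENNReal.ofReal (Real.exp (1 * s))), withDensity_absolutelyContinuous _ _ hμ₁0,
    fun t ht => ?_⟩
  -- a shift `ε < min t 1`
  set ε : ℝ := min (t / 2) (1 / 2) with hε_def
  have hε : 0 < ε := lt_min (by positivity) (by norm_num)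
  have hεt : ε < t := (min_le_left _ _).trans_lt (by linarith)
  have hε1 : ε < 1 := (min_le_right _ _).trans_lt (by norm_num)
  obtain ⟨μ₂, hfin₂, hμ₂0, hrep₂, -⟩ := hshift ε hε
  -- the finite measures `e^{-(1-ε)s} μ₂` and `μ₁` coincide
  set A : Measure ℝ := μ₂.withDensity (fun s => ENNReal.ofReal (Real.exp (-(1 - ε) * s))) with hA_def
  have hA_lint : ∀ u : ℝ, 0 ≤ u → ∫⁻ s, ENNReal.ofReal (Real.exp (-(u * s))) ∂A = ENNReal.ofReal (f (u + 1)) := by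
    intro u hu
    rw [hA_def, lintegral_withDensity_eq_lintegral_mul _ (hmeas (-(1 - ε))) (by
      simpa only [neg_mul] using hmeas (-u))]
    have e1 : (fun s => ENNReal.ofReal (Real.exp (-(1 - ε) * s))) * (fun s => ENNReal.ofReal (Real.exp (-(u * s)))) =
        fun s => ENNReal.ofReal (Real.exp (-((u + 1 - ε) * s))) := by
      funext s
      simp only [Pi.mul_apply]
      rw [show -(u * s) = (-u) * s by ring, hmul, show -((u + 1 - ε) * s) = (-(1 - ε) + -u) * s by ring]
    rw [e1, lintegral_exp_neg_eq_ofReal hμ₂0 hrep₂ (by linarith : 0 < u + 1 - ε)]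
    congr 2; ring
  haveI : IsFiniteMeasure A := by
    refine isFiniteMeasure_withDensity_ofReal ?_
    have hae : ∀ᵐ s ∂μ₂, s ∈ Ici (0 : ℝ) := by
      rw [ae_iff]
      have : {a : ℝ | a ∉ Ici (0 : ℝ)} = Iio 0 := by ext a; simp
      rwa [this]
    refine ((integrable_const (1 : ℝ)).mono' (by fun_prop) ?_).hasFiniteIntegral
    filter_upwards [hae] with s hs
    rw [Real.norm_eq_abs, abs_of_pos (Real.exp_pos _)]
    exact Real.exp_le_one_iff.2 (by nlinarith [mem_Ici.1 hs])
  have hμ₁_lint : ∀ u : ℝ, 0 < u → ∫⁻ s, ENNReal.ofReal (Real.exp (-(u * s))) ∂μ₁ = ENNReal.ofReal (f (u + 1)) :=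
    fun u hu => lintegral_exp_neg_eq_ofReal hμ₁0 hrep₁ hu
  have hAμ : A = μ₁ := by
    refine measure_eq_of_lintegral_exp_neg_nat_mul_eq (withDensity_absolutelyContinuous _ _ hμ₂0) hμ₁0 fun n => ?_
    rcases Nat.eq_zero_or_pos n with hn | hn
    · subst hn
      rw [Nat.cast_zero, hA_lint _ le_rfl]
      have e0 : (fun a : ℝ => ENNReal.ofReal (Real.exp (-((0 : ℝ) * a)))) = fun _ => 1 := by
        funext a; simp
      rw [e0, lintegral_const, one_mul, zero_add, ← hmass₁]
      exact ENNReal.ofReal_toReal (measure_ne_top _ _)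
    · rw [hA_lint _ (by positivity), hμ₁_lint _ (by positivity)]
  -- the Laplace transform of `μ = e^{s} μ₁` at `t`
  have hlint : ∫⁻ s, ENNReal.ofReal (Real.exp (-(t * s))) ∂(μ₁.withDensity (fun s => ENNReal.ofReal (Real.exp (1 * s)))) =
      ENNReal.ofReal (f t) := by
    rw [lintegral_withDensity_eq_lintegral_mul _ (hmeas 1) (by simpa only [neg_mul] using hmeas (-t))]
    have e1 : (fun s => ENNReal.ofReal (Real.exp (1 * s))) * (fun s => ENNReal.ofReal (Real.exp (-(t * s)))) =
        fun s => ENNReal.ofReal (Real.exp (-((t - 1) * s))) := by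
      funext s
      simp only [Pi.mul_apply]
      rw [show -(t * s) = (-t) * s by ring, hmul]
      congr 2; ring
    rw [e1, ← hAμ, hA_def, lintegral_withDensity_eq_lintegral_mul _ (hmeas (-(1 - ε)))
      (by simpa only [neg_mul] using hmeas (-(t - 1)))]
    have e2 : (fun s => ENNReal.ofReal (Real.exp (-(1 - ε) * s))) * (fun s => ENNReal.ofReal (Real.exp (-((t - 1) * s)))) =
        fun s => ENNReal.ofReal (Real.exp (-((t - ε) * s))) := by
      funext s
      simp only [Pi.mul_apply]
      rw [show -((t - 1) * s) = (-(t - 1)) * s by ring, hmul]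
      congr 2; ring
    rw [e2, lintegral_exp_neg_eq_ofReal hμ₂0 hrep₂ (by linarith : 0 < t - ε)]
    congr 2; ring
  -- back to Bochner integrals
  have hsm : AEStronglyMeasurable (fun s => Real.exp (-(t * s)))
      (μ₁.withDensity (fun s => ENNReal.ofReal (Real.exp (1 * s)))) := by fun_prop
  have hnn : 0 ≤ᵐ[μ₁.withDensity (fun s => ENNReal.ofReal (Real.exp (1 * s)))] fun s => Real.exp (-(t * s)) :=
    ae_of_all _ fun s => (Real.exp_pos _).le
  have hint : Integrable (fun s => Real.exp (-(t * s))) (μ₁.withDensity (fun s => ENNReal.ofReal (Real.exp (1 * s)))) := by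
    refine ⟨hsm, ?_⟩
    rw [hasFiniteIntegral_iff_ofReal hnn, hlint]
    exact ENNReal.ofReal_lt_top
  refine ⟨hint, ?_⟩
  rw [integral_eq_lintegral_of_nonneg_ae hnn hsm, hlint, ENNReal.toReal_ofReal (SemigroupPosDef.nonneg h ht)]

end Literature.MeasureTheory.Integral

end
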